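import Summits.BirchSwinnertonDyer.BirchSwinnertonDyer.Theorems.PrintCf2RubinValueTwoLinePinDefectCharIdealOfCorank
import Summits.BirchSwinnertonDyer.BirchSwinnertonDyer.Theorems.EisensteinPrimesAnomalousUnramifiedKernelFinite
import Literature.NumberTheory.EllipticCurves.Kobayashi2003.FineSelmerLeSignedSelmerProofs
import HarnessLib

/-!
# M-LINE-PIN, (C2b) part 4: AN UNDECOMPOSED `v̄` — from «`D_{v̄} ⊄ κ⁻¹(pℤ_p)`» (no splitting in the first layer) to the
# decomposition element `τ` with `κ τ = κ γ`, and the packaged (C2b) statement for the class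

Cell `bsd-print-cf2`, width seat `bsd-line-cf2c-w8` g4 (prover-bsd-line-cf2c-w8-g4-0), planner g19's named piece M-LINE-PIN, step (C2b)
(memo `Cruxes/TwoVariableMainConjAtSplitTwo/M-LINE-PIN-cf2c-w8g3.md` §2/§8); sequel of parts 1–3 (p700499, p701343, p701925).
`--supports stmt-BirchSwinnertonDyer-24086 --as helper`, Theses-free. HONEST FRAMING: parts 2–3 are stated for a decomposition element
`τ ∈ D_{v̄}` with `κ τ = κ γ` (i.e. `v̄` UNDECOMPOSED in the first slot's line); this file (§1) produces such a `τ` from the layer-one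
statement «`D_{v̄} ⊄ κ⁻¹(pℤ_p)`» = «`v̄` does not split in the first layer `K₁`» (for `K = ℚ(√−7)`, `p = 2`, the line unramified outside
`v`: `K₁ = K(√−π)`, and `−π ≡ 5 (mod v̄³)` is not a square in `K_{v̄} = ℚ₂` — that dyadic Kummer fact is NOT proved here; it is the
displayed input `hU`), and (§2) packages parts 1–3 into ONE statement whose displayed inputs are `hU`, «every `τ ∈ D_{v̄}` acts on `M` as
an integer `≡ 1 (mod p)`» (for `M = A_θ`, `p = 2`: `θ(τ) = ±1`, automatic) and the corank (LS)_v. No summit statement is proved by this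
seat; BSD is not proved by any of this. THEOREMS ONLY (no definition, no named fact, no `sorry`).

* §1 `exists_mem_decomp_apply_eq_of_not_le_layerSubgroup_one` (generic `K`, `p`, `κ`, finite place `w`): if `D_w ⊄ κ⁻¹(pℤ_p)` then for a
  topological generator `γ` of `κ` there is `τ ∈ D_w` with `κ τ = κ γ` (`ℤ_p`-saturation of the closed subgroup `D_w`:
  `AnomalousLocalTorsion.exists_mem_apply_toAdd_eq_of_dvd`).
* §2 `exists_charIdeal_ker_liftQ_eq_span_pow_zpCorank_of_not_le_layerSubgroup_one` — parts 1–3 with `τ` produced by §1.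
presearch: Washington §13.1 (closed subgroups of `ℤ_p`), Neukirch II (9.6) — tree theorems; assembly. beyond-print theorem: no.

References: [Washington1997] §13.1–13.2; [NeukirchANT1999] Ch. II §9 (9.6); [GreenbergVatsal2000] §2 Prop. (2.4).
-/

noncomputable section

open scoped Classical Pointwise AddSubgroup

-- the summit namespace `Summit.BirchSwinnertonDyer.BirchSwinnertonDyer` repeats the problem name by design (D-0017)
set_option linter.dupNamespace false
set_option autoImplicit false

open NumberField IsDedekindDomain Field Literature.NumberTheory.GaloisRepresentations
  Literature.NumberTheory.EllipticCurves Literature.NumberTheory.EllipticCurves.Module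
  Literature.NumberTheory.EllipticCurves.IwasawaAlgebra Literature.NumberTheory.EllipticCurves.GreenbergSelmer
  Literature.NumberTheory.EllipticCurves.GreenbergVatsal2000 Literature.NumberTheory.EllipticCurves.KellerYin2024
  Literature.NumberTheory.EllipticCurves.IwasawaDual


namespace Summit.BirchSwinnertonDyer.BirchSwinnertonDyer.Theorems.PrintCf2.LinePin

/-! ## §1. `D_w ⊄ κ⁻¹(pℤ_p)` ⟹ a decomposition element with `κ τ = κ γ` -/

section Undecomposed

variable {K : Type} [Field K] [NumberField K] {p : ℕ} [Fact p.Prime]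

/-- **An undecomposed place carries a decomposition element of `κ`-value `κ γ`.** If the decomposition group `D_w` is not contained in
`κ⁻¹(pℤ_p)` — i.e. `w` does NOT split completely in the first layer `K₁` of the `ℤ_p`-extension, equivalently `κ(D_w) = ℤ_p`
(`D_w` surjects onto `Gal(K_∞/K)`: `w` is undecomposed in `K_∞`) — then for every topological generator `γ` there is `τ ∈ D_w` with
`κ τ = κ γ` (`D_w` is closed and `κ(D_w) ∋` a unit, so `κ(D_w) = ℤ_p`). This is the hypothesis `hκτ : κ τ = κ γ` of parts 2–3.
[cite: Washington1997, §13.1] [cite: NeukirchANT1999, Ch. II §9 Prop. (9.6)] -/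
theorem exists_mem_decomp_apply_eq_of_not_le_layerSubgroup_one (κ : ZpExtension K p) {w : HeightOneSpectrum (𝓞 K)}
    (hD : ¬ decomp w ≤ κ.layerSubgroup 1) {γ : absoluteGaloisGroup K} (hγ : κ.IsTopGenerator γ) :
    ∃ τ ∈ decomp w, κ τ = κ γ := by
  obtain ⟨τ₁, hτ₁, hnot⟩ := SetLike.not_le_iff_exists.mp hD
  rw [ZpExtension.mem_layerSubgroup, pow_one] at hnot
  have hne : κ τ₁ ≠ 1 := by
    intro h
    apply hnot
    rw [h]
    exact ⟨0, by rw [mul_zero]; rfl⟩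
  -- the valuation of `κ τ₁` is `0`
  have hval : ((κ τ₁).toAdd).valuation = 0 := by
    by_contra hv
    apply hnot
    have hb0 : (κ τ₁).toAdd ≠ 0 := fun h0 ↦ hne (by rw [← ofAdd_toAdd (κ τ₁), h0]; rfl)
    rw [PadicInt.unitCoeff_spec hb0]
    exact dvd_mul_of_dvd_right (dvd_pow_self _ hv) _
  have hclosed : IsClosed (decomp w : Set (absoluteGaloisGroup K)) := (Kobayashi2003.isCompact_decomp w).isClosed
  obtain ⟨τ, hτ, hτv⟩ := AnomalousLocalTorsion.exists_mem_apply_toAdd_eq_of_dvd κ (decomp w) hclosed hτ₁ hne (x := 1)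
    (by rw [hval, pow_zero])
  refine ⟨τ, hτ, ?_⟩
  rw [hγ, ← ofAdd_toAdd (κ τ), hτv]

end Undecomposed

/-! ## §2. The packaged (C2b) statement for an undecomposed `v̄` -/

section Packaged

variable {K : Type} [Field K] [NumberField K] {p : ℕ} [Fact p.Prime] {κ κ₂ : ZpExtension K p}
  {M : Type} [AddCommGroup M] [DistribMulAction (absoluteGaloisGroup K) M] [TopologicalSpace M] [DiscreteTopology M]
  {𝔮 : HeightOneSpectrum (𝓞 K)} {γ γ₂ : absoluteGaloisGroup K}
  {g : unrSelmer κ M 𝔮 ∅ →+ unrSelmer₂ κ κ₂ M 𝔮}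
  (hg : ∀ t : unrSelmer κ M 𝔮 ∅,
    ((g t : unrSelmer₂ κ κ₂ M 𝔮) : subgroupH1 (ZpExtension.pairKer κ κ₂) M) =
      resOfLe M (ZpExtension.pairKer_le_left κ κ₂) (t : subgroupH1 κ.kerSubgroup M))
  {D₂ : DualData₂ κ κ₂ M 𝔮 γ γ₂} {D₁ : DatumDualData κ γ M (Castella2018.AcSelmer.bdpData M p 𝔮) ∅}
  {φ : D₂.X →ₛₗ[PowerSeries.map (PowerSeries.constantCoeff (R := ℤ_[p]))] D₁.X}
  (hφ : ∀ (x : D₂.X) (t : unrSelmer κ M 𝔮 ∅), D₁.toDual (φ x) t = D₂.toDual x (g t))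
include hg hφ

/-- **(C2b) FOR AN UNDECOMPOSED `v̄`, PACKAGED.** Slot-1 control `g` with transpose `φ` ((C1)), generator pair, `M` discrete `p`-primary with
continuous orbits, partner `κ₂` unramified outside `𝔮 = v̄`, `pairKer ⊓ I_𝔮` trivial on `M`, every `τ ∈ D_𝔮` acting on `M` as some integer
(`M = A_θ`: `θ(τ) = ±1`), `D₂.X` f.g. over `Λ₂`, and **`hU : D_𝔮 ⊄ κ⁻¹(pℤ_p)`** (`v̄` undecomposed in the line). Then there are `τ ∈ D_𝔮`,
`u : ℤ` with `κ τ = κ γ`, `τ • m = u • m`, and — if `u ≡ 1 (mod p)` (automatic for `p = 2`, `u = ±1`) — for ANY `Λ`-linear descent `φ̄` of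
`φ` and ANY presentation `πC` of the cokernel of control: `C[p]` finite and
**`ch_Λ(ker φ̄) = ((1+T) − u)^{corank_{ℤ_p} C}`**; so (LS)_v «`corank_{ℤ_p} C = 1`» gives `ch_Λ(ker φ̄) = ((1+T) − u)`, the Euler factor at
`v̄`. [cite: GreenbergVatsal2000, §2 Cor. (2.3), Prop. (2.4)] [cite: GreenbergLNM1716, §1, §3–4] [cite: Washington1997, §13.1–13.2] -/
theorem exists_charIdeal_ker_liftQ_eq_span_pow_zpCorank_of_not_le_layerSubgroup_one [Module.Finite (IwasawaAlgebra₂ p) D₂.X]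
    (hγ : ZpExtension.IsTopGeneratorPair κ κ₂ γ γ₂)
    (hcont : ∀ m : M, Continuous fun σ : absoluteGaloisGroup K ↦ σ • m) (hprim : ∀ m : M, ∃ k : ℕ, p ^ k • m = 0)
    (hκ₂ : κ₂.IsUnramifiedOutside 𝔮) (h𝔮 : ((p : ℕ) : 𝓞 K) ∈ 𝔮.asIdeal)
    (hI : ∀ y : absoluteGaloisGroup K, y ∈ ZpExtension.pairKer κ κ₂ → y ∈ inertia 𝔮 → ∀ m : M, y • m = m)
    (hint : ∀ τ : absoluteGaloisGroup K, τ ∈ decomp 𝔮 → ∃ u : ℤ, ∀ m : M, τ • m = u • m)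
    (hU : ¬ decomp 𝔮 ≤ κ.layerSubgroup 1)
    {C : Type*} [AddCommGroup C] (πC : ↥(endInvariants (conjSel₂ κ κ₂ M 𝔮 γ₂ - 1)) →+ C) (hsurj : Function.Surjective πC)
    (hker : ∀ s : ↥(endInvariants (conjSel₂ κ κ₂ M 𝔮 γ₂ - 1)), πC s = 0 ↔ (s : unrSelmer₂ κ κ₂ M 𝔮) ∈ g.range) :
    letI : Module (IwasawaAlgebra p) (QuotSMulTop (PowerSeries.C (PowerSeries.X : IwasawaAlgebra p) : IwasawaAlgebra₂ p) D₂.X) :=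
      Module.compHom _ (PowerSeries.map (PowerSeries.C (R := ℤ_[p])))
    ∃ τ ∈ decomp 𝔮, ∃ u : ℤ, κ τ = κ γ ∧ (∀ m : M, τ • m = u • m) ∧
      ((p : ℤ) ∣ u - 1 →
        ∀ (φbar : QuotSMulTop (PowerSeries.C (PowerSeries.X : IwasawaAlgebra p) : IwasawaAlgebra₂ p) D₂.X →ₗ[IwasawaAlgebra p] D₁.X),
          (∀ x : D₂.X, φbar (Submodule.Quotient.mk x) = φ x) →
          Finite (C[(p : ℤ)]) ∧
            charIdeal (IwasawaAlgebra p) (LinearMap.ker φbar) =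
              Ideal.span {((1 : IwasawaAlgebra p) + PowerSeries.X) - (u : IwasawaAlgebra p)} ^ zpCorank C p) := by
  obtain ⟨τ, hτ, hκτ⟩ := exists_mem_decomp_apply_eq_of_not_le_layerSubgroup_one κ hU hγ.left
  obtain ⟨u, hu⟩ := hint τ hτ
  refine ⟨τ, hτ, u, hκτ, hu, fun hpu φbar hφbar ↦ ⟨?_, ?_⟩⟩
  · exact (finite_torsionBy_and_zpCorank_eq_lambdaInvariant_ker_liftQ hg hφ hγ hcont hprim hκ₂ h𝔮 hI hτ hκτ hu hpu
      πC hsurj hker φbar hφbar).1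
  · exact charIdeal_ker_liftQ_eq_span_pow_zpCorank hg hφ hγ hcont hprim hκ₂ h𝔮 hI hτ hκτ hu hpu πC hsurj hker φbar hφbar

end Packaged

end Summit.BirchSwinnertonDyer.BirchSwinnertonDyer.Theorems.PrintCf2.LinePin

end
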